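import Summits.AtomisticToContinuum.HydrodynamicLimit.Theses.LambertianContactSwap
import Summits.AtomisticToContinuum.HydrodynamicLimit.Theorems.LambertianContactSwapSwapGapLiouvilleInvarianceLambda
import Summits.AtomisticToContinuum.HydrodynamicLimit.Theorems.LambertianContactSwapLambertianEulerFwdGood
import Summits.AtomisticToContinuum.HydrodynamicLimit.Theorems.LambertianContactSwapLambertianEulerGibbsInvariance
import HarnessLib

/-!
# The Λ-Liouville theorem, assembled (crux `LambertianContactSwap.LambertianEuler`, stmt-AtomisticToContinuum-11854, line `Sketch`)

The Liouville block of the lead skeleton v11 of line `Sketch`, taken out of the crux workfile and landed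
as theorems usable by the other items of the route (`SwapGap`, `LambertianWellPosed`) and by the tails
ladder: for the LAMBERTIAN hard-sphere flow `Λ` on `𝕋³` (`lambertFlow`; cosine-law random redraw of the
colliding pair, i.i.d. Gaussian noise `lambertNoise`),

* (the invariance `(liouville ⊗ γ^ℕ) ∘ Λ_t⁻¹ = liouville` itself and a.e. non-accumulation — WINDOW p112254
  + MARKOV p110886 + ITERATE p113149 of this line — were assembled first by the sibling line of `SwapGap` as
  `…SwapGapLiouvilleInvarianceLambda.stub_liouvilleInvarianceLambda` / `nonAccumulationLambda`; reused here);
* `gibbsInvarianceLambda_holds` — the canonical hard-sphere Gibbs laws with constant profiles are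
  `Λ`-invariant for `0 < σ < 1/2` (from the above and the landed `stub_gibbsInvariance`, p106034);
* `lambertianWellPosed_holds` — the route support `LambertianWellPosed` (stmt-AtomisticToContinuum-12101:
  joint measurability of every `Λ_t`, and `liouville ⊗ γ^ℕ`-a.e. forward regularity of the `ξ`-driven
  recursion: simple incoming exits, no grazing inside free flights, exit times summing to `∞`) from the
  Literature measurability and the landed a.e. forward regularity `lambert_ae_fwdGood` (p116158); the
  route decl is the same term as its named-API form (the `let` block is the Lambertian API verbatim).

All [folklore] given the cited landed files. Lead prover-line-stmt-AtomisticToContinuum-11854-c1-0.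
-/

noncomputable section

namespace Summit.AtomisticToContinuum.HydrodynamicLimit.Theorems.LambertianContactSwapLambertianEulerLiouville

open scoped BigOperators Topology ENNReal InnerProductSpace
open MeasureTheory ProbabilityTheory Filter Set
open Literature.MathematicalPhysics.KineticTheory
open Literature.Analysis.FluidPDE Literature.Analysis.FluidPDE.Alexander

/-- **`Λ`-invariance of the canonical hard-sphere Gibbs laws** with constant profiles `a, θ > 0`, `u`
(`0 < σ < 1/2`, every `N`, every flow fixing the phase space, `t ≥ 0`): the law of `Λ_t` under
`G_N ⊗ γ^ℕ` is `G_N` — the equilibrium case of the crux and the reference input of the relative-entropy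
method. [folklore] -/
theorem gibbsInvarianceLambda_holds :
    ∀ σ : ℝ, 0 < σ → σ < 2⁻¹ → ∀ (N : ℕ) (a θ : ℝ) (u : V3), 0 < a → 0 < θ →
      ∀ Φ : HardSphereFlow (Torus.geometry (Fin 3)) (hsDiameter σ N) (N + 1),
      ∀ t : ℝ, 0 ≤ t →
        ((localGibbsLaw σ (fun _ => a) (fun _ => u) (fun _ => θ) N Φ).prod (lambertNoise (Fin 3))).map
          (fun p => lambertFlow (Torus.geometry (Fin 3)) (hsDiameter σ N) p.2 p.1 t) =
        localGibbsLaw σ (fun _ => a) (fun _ => u) (fun _ => θ) N Φ :=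
  LambertianContactSwapLambertianEulerGibbsInvariance.stub_gibbsInvariance
    LambertianContactSwapSwapGapLiouvilleInvarianceLambda.stub_liouvilleInvarianceLambda

/-- If every horizon is passed by some partial sum of a sequence in `ℝ≥0∞`, the series sums to `∞`.
[folklore] -/
theorem tsum_eq_top_of_forall_exists_lt {f : ℕ → ℝ≥0∞}
    (h : ∀ T : ℝ, ∃ k, ENNReal.ofReal T < ∑ m ∈ Finset.range k, f m) : ∑' m, f m = ⊤ := by
  by_contra hne
  obtain ⟨k, hk⟩ := h ((∑' m, f m).toReal + 1)
  have hle : ∑ m ∈ Finset.range k, f m ≤ ∑' m, f m := ENNReal.sum_le_tsum _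
  have h1 : ENNReal.ofReal ((∑' m, f m).toReal + 1) < ∑' m, f m := hk.trans_le hle
  have h1' : ENNReal.ofReal ((∑' m, f m).toReal + 1) < ENNReal.ofReal (∑' m, f m).toReal := by
    rw [ENNReal.ofReal_toReal hne]; exact h1
  have h2 := (ENNReal.ofReal_lt_ofReal_iff_of_nonneg (by positivity)).1 h1'
  linarith

/-- **The route support `LambertianWellPosed` (stmt-AtomisticToContinuum-12101) holds**: for
`0 < σ < 1/2` and every `N`, (a) each `(z, ξs) ↦ Λ_t(z, ξs)` is jointly measurable
(`measurable_lambertFlow_hsDiameter`), and (b) for `liouville ⊗ γ^ℕ`-a.e. `(z, ξs)` every finite exit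
configuration of the `ξ`-driven recursion is a simple incoming collision, no pair is in contact strictly
inside a free flight, and the exit times sum to `∞` (`lambert_ae_fwdGood` at `ε = hsDiameter σ N`,
`N + 1` spheres; the last clause from non-accumulation by `tsum_eq_top_of_forall_exists_lt`). The route
decl's `let` block is the Lambertian API verbatim, so the statement is closed by definitional unfolding.
[folklore] -/
theorem lambertianWellPosed_holds :
    Summit.AtomisticToContinuum.HydrodynamicLimit.Theses.LambertianContactSwap.LambertianWellPosed := by
  intro σ hσ hσ' N
  have hε : 0 < hsDiameter σ N := hsDiameter_pos hσ N
  have hε' : hsDiameter σ N < 2⁻¹ := (hsDiameter_le hσ.le N).trans_lt hσ'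
  refine ⟨fun t => measurable_lambertFlow_hsDiameter hσ.le hσ' N t, ?_⟩
  filter_upwards [LambertianContactSwapLambertianEulerFwdGood.lambert_ae_fwdGood hε hε' (N := N + 1)]
    with p hp
  exact ⟨hp.1, hp.2.1, tsum_eq_top_of_forall_exists_lt hp.2.2⟩

end Summit.AtomisticToContinuum.HydrodynamicLimit.Theorems.LambertianContactSwapLambertianEulerLiouville

end
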